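import Summits.AtomisticToContinuum.HydrodynamicLimit.Theorems.MourreKoopmanChargesStressStrongMixingLowDensityGibbsUniqueness3Cloud
import Mathlib.Analysis.SpecificLimits.Basic
import HarnessLib

/-!
# `StressStrongMixing` · line `birth`, stub `stub_lowDensityGibbsUniqueness3` (infrastructure 2/3):
# elementary estimates and the intensity `z · Leb ⊗ M`

Support file for the crux item stmt-AtomisticToContinuum-9584 (`StressStrongMixing`, route
`MourreKoopmanCharges` of `AtomisticToContinuum/HydrodynamicLimit`), serving the registered stub
`stub_lowDensityGibbsUniqueness3` of `Cruxes/StressStrongMixing/Lines/birth.lean`.  Small lemmas used by the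
Lipschitz bound on the activity-dependence of the vacancy probability (companion file `…Lipschitz`):

* `add_three_pow_three_le`, `pow_mul_cube_le` — the geometric–polynomial majorant `(16z)ᵏ · 8δ(k+3)³ ≤ 216 δ 2⁻ᵏ`
  for `16 z ≤ 1/6`;
* `ofReal_abs_le_tsum_of_decay` — from a decay estimate indexed by the first present obstruction to a summable
  majorant `∑ₖ qᵏ 1[obstruction k]`;
* `biUnion_window_ball_inter_eq_empty` — a cloud with no centre in `B(0, r+1)` forbids nothing in `B(0, r)`;
* `smul_prod_eq_add`, `smul_prod_window_ne_top`, `real_restrict_window_ball_le`, `restrict_window_ball_le` — the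
  intensity `z · Leb ⊗ M` on `ℝ³ × ℝ³`: additivity in `z`, finiteness on bounded windows, `≤ 8z` on unit ball windows,
  `≤ 8δ(k+3)³` on the ball `B(0, k+3)`.
-/

noncomputable section

open MeasureTheory ProbabilityTheory Set Filter Function
open scoped ENNReal NNReal Topology

namespace Summit.AtomisticToContinuum.HydrodynamicLimit.Theorems.MourreKoopmanChargesStressStrongMixing

open Literature.Analysis.FunctionSpaces
open Literature.MathematicalPhysics.KineticTheory
open Literature.MathematicalPhysics.StatisticalMechanics
open Literature.MathematicalPhysics.StatisticalMechanics.HardSphere (Pos Phase window hardCoreSet glue poissonLaw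
  IsHardCore)

/-! ## Elementary estimates -/

/-- `(k+3)³ ≤ 27 · 3ᵏ`. -/
theorem add_three_pow_three_le (k : ℕ) : ((k : ℝ) + 3) ^ 3 ≤ 27 * 3 ^ k := by
  induction k with
  | zero => norm_num
  | succ k ih =>
    have hk : (0 : ℝ) ≤ k := Nat.cast_nonneg k
    calc (((k + 1 : ℕ) : ℝ) + 3) ^ 3 = ((k : ℝ) + 4) ^ 3 := by push_cast; ring
      _ ≤ 3 * ((k : ℝ) + 3) ^ 3 := by nlinarith [sq_nonneg (k : ℝ)]
      _ ≤ 3 * (27 * 3 ^ k) := by linarith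
      _ = 27 * 3 ^ (k + 1) := by ring

/-- The geometric–polynomial term: for `0 ≤ q ≤ 1/6` and `δ ≥ 0`, `qᵏ · 8δ(k+3)³ ≤ 216 δ 2⁻ᵏ`. -/
theorem pow_mul_cube_le {q δ : ℝ} (hq0 : 0 ≤ q) (hq : q ≤ 1 / 6) (hδ : 0 ≤ δ) (k : ℕ) :
    q ^ k * (8 * δ * ((k : ℝ) + 3) ^ 3) ≤ 216 * δ * (2⁻¹) ^ k := by
  have h1 : q ^ k ≤ (1 / 6) ^ k := pow_le_pow_left₀ hq0 hq k
  have h2 := add_three_pow_three_le k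
  calc q ^ k * (8 * δ * ((k : ℝ) + 3) ^ 3) ≤ (1 / 6) ^ k * (8 * δ * (27 * 3 ^ k)) := by
        gcongr
    _ = 216 * δ * ((1 / 6) ^ k * 3 ^ k) := by ring
    _ = 216 * δ * (2⁻¹) ^ k := by rw [← mul_pow]; norm_num

/-- **From decay to a summable majorant.** If `|x| ≤ 1` and `|x| ≤ q^{k+1}` whenever the `k`-th obstruction is
absent (`¬ B k`), with `0 ≤ q < 1`, then `|x| ≤ ∑ₖ qᵏ 1[B k]` (in `ℝ≥0∞`): either some obstruction is present,
and the first one pays, or none is and `x = 0`. -/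
theorem ofReal_abs_le_tsum_of_decay {x q : ℝ} (hq0 : 0 ≤ q) (hq1 : q < 1) (hx : |x| ≤ 1) (B : ℕ → Prop)
    [DecidablePred B] (hdec : ∀ k, ¬ B k → |x| ≤ q ^ (k + 1)) :
    ENNReal.ofReal |x| ≤ ∑' k, ENNReal.ofReal (q ^ k) * (if B k then 1 else 0) := by
  classical
  by_cases hex : ∃ k, B k
  · obtain ⟨j, hBj, hmin⟩ : ∃ j, B j ∧ ∀ i < j, ¬ B i :=
      ⟨Nat.find hex, Nat.find_spec hex, fun i hi => Nat.find_min hex hi⟩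
    have hxj : |x| ≤ q ^ j := by
      by_cases hj0 : j = 0
      · rw [hj0, pow_zero]; exact hx
      · obtain ⟨i, rfl⟩ := Nat.exists_eq_succ_of_ne_zero hj0
        exact hdec i (hmin i (Nat.lt_succ_self i))
    calc ENNReal.ofReal |x| ≤ ENNReal.ofReal (q ^ j) := ENNReal.ofReal_le_ofReal hxj
      _ = ENNReal.ofReal (q ^ j) * (if B j then 1 else 0) := by rw [if_pos hBj, mul_one]
      _ ≤ ∑' k, ENNReal.ofReal (q ^ k) * (if B k then 1 else 0) :=
          ENNReal.le_tsum (f := fun k => ENNReal.ofReal (q ^ k) * (if B k then 1 else 0)) j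
  · push Not at hex
    have hle : ∀ k, |x| ≤ q ^ (k + 1) := fun k => hdec k (hex k)
    have htend : Tendsto (fun k : ℕ => q ^ (k + 1)) atTop (𝓝 0) :=
      (tendsto_pow_atTop_nhds_zero_of_lt_one hq0 hq1).comp (tendsto_add_atTop_nat 1)
    have h0 : |x| ≤ 0 := ge_of_tendsto' htend hle
    rw [le_antisymm h0 (abs_nonneg x), ENNReal.ofReal_zero]
    exact bot_le

/-- A cloud with no centre in `B(0, r+1)` forbids nothing inside `B(0, r)` (unit diameter). -/
theorem biUnion_window_ball_inter_eq_empty {D : PointConfig Phase} {r : ℝ}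
    (hD : D.count (window (Metric.ball (0 : Pos) (r + 1))) = 0) :
    (⋃ x ∈ (D : Set Phase), window (Metric.ball x.1 1)) ∩ window (Metric.ball (0 : Pos) r) = ∅ := by
  refine eq_empty_of_forall_notMem fun y hy => ?_
  obtain ⟨x, hx, hxy⟩ := mem_biUnion_window_ball_iff.1 hy.1
  have hx' : x ∉ window (Metric.ball (0 : Pos) (r + 1)) := (count_eq_zero_iff'.1 hD) x hx
  rw [HardSphere.mem_window, Metric.mem_ball, dist_zero_right, not_lt] at hx'
  have hy' := hy.2
  rw [HardSphere.mem_window, Metric.mem_ball, dist_zero_right] at hy'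
  have h := norm_sub_norm_le x.1 y.1
  rw [← dist_eq_norm, dist_comm] at h
  linarith

/-! ## The intensity `z · Leb ⊗ M` -/

section Intensity

/-- Additivity of the intensity in the activity: `z' · Leb ⊗ M = (z' - z) · Leb ⊗ M + z · Leb ⊗ M`. -/
theorem smul_prod_eq_add (M : Measure Pos) {z z' : ℝ} (hz : 0 ≤ z) (hzz' : z ≤ z') :
    (Real.toNNReal z') • ((volume : Measure Pos).prod M) =
      (Real.toNNReal (z' - z)) • ((volume : Measure Pos).prod M) + (Real.toNNReal z) • ((volume : Measure Pos).prod M) := by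
  rw [← add_smul, ← Real.toNNReal_add (sub_nonneg.2 hzz') hz, sub_add_cancel]

variable (M : Measure Pos) [IsProbabilityMeasure M]

/-- The intensity gives finite mass to the windows of bounded regions. -/
theorem smul_prod_window_ne_top (z : ℝ) {Λ : Set Pos} (hΛ : Bornology.IsBounded Λ) :
    ((Real.toNNReal z) • ((volume : Measure Pos).prod M)) (window Λ) ≠ ∞ := by
  rw [smul_prod_window, measure_univ, mul_one]
  exact ENNReal.mul_ne_top ENNReal.ofReal_ne_top hΛ.measure_lt_top.ne

/-- The intensity of a unit ball window is at most `8 z`, also after restriction. -/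
theorem real_restrict_window_ball_le {z : ℝ} (hz : 0 ≤ z) (s : Set Phase) (a : Pos) :
    (((Real.toNNReal z) • ((volume : Measure Pos).prod M)).restrict s).real (window (Metric.ball a 1)) ≤ 8 * z := by
  rw [measureReal_def]
  have h1 : (((Real.toNNReal z) • ((volume : Measure Pos).prod M)).restrict s) (window (Metric.ball a 1)) ≤
      ENNReal.ofReal (8 * z) := by
    refine (Measure.restrict_apply_le _ _).trans ?_
    rw [smul_prod_window, measure_univ, mul_one, mul_comm (8 : ℝ) z, ENNReal.ofReal_mul hz]
    gcongr
    exact volume_ball_one_le a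
  calc _ ≤ (ENNReal.ofReal (8 * z)).toReal := ENNReal.toReal_mono ENNReal.ofReal_ne_top h1
    _ = 8 * z := ENNReal.toReal_ofReal (by positivity)

/-- The restricted intensity of the ball `B(0, k+3)` window is at most `8 δ (k+3)³`. -/
theorem restrict_window_ball_le {δ : ℝ} (hδ : 0 ≤ δ) (s : Set Phase) (k : ℕ) :
    (((Real.toNNReal δ) • ((volume : Measure Pos).prod M)).restrict s) (window (Metric.ball (0 : Pos) ((k : ℝ) + 3))) ≤
      ENNReal.ofReal (8 * δ * ((k : ℝ) + 3) ^ 3) := by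
  refine (Measure.restrict_apply_le _ _).trans ?_
  have hk : (0 : ℝ) ≤ (k : ℝ) + 3 := by positivity
  rw [smul_prod_window, measure_univ, mul_one, show 8 * δ * ((k : ℝ) + 3) ^ 3 = δ * (2 * ((k : ℝ) + 3)) ^ 3 by ring,
    ENNReal.ofReal_mul hδ, ENNReal.ofReal_pow (by positivity)]
  gcongr
  exact volume_ball_le 0 _

end Intensity

/-- **Registered helper stub (infrastructure 2/3 of `stub_lowDensityGibbsUniqueness3`)**: the decay-to-majorant
lemma `ofReal_abs_le_tsum_of_decay` in closed form. -/
theorem lowDensityGibbsUniqueness3_decayMajorant : ∀ (x q : ℝ), 0 ≤ q → q < 1 → |x| ≤ 1 → ∀ (B : ℕ → Prop) [DecidablePred B], (∀ k, ¬ B k → |x| ≤ q ^ (k + 1)) → ENNReal.ofReal |x| ≤ ∑' k, ENNReal.ofReal (q ^ k) * (if B k then 1 else 0) :=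
  fun _ _ hq0 hq1 hx B _ hdec => ofReal_abs_le_tsum_of_decay hq0 hq1 hx B hdec

end Summit.AtomisticToContinuum.HydrodynamicLimit.Theorems.MourreKoopmanChargesStressStrongMixing

end
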